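import Literature.MathematicalPhysics.QuantumLattice.QuasiLocalAverageProofs
import Literature.MathematicalPhysics.QuantumLattice.TorusLiebRobinsonProofs
import Mathlib.Analysis.Complex.Exponential
import HarnessLib

/-!
# MZ13 Lemma 1 (iv): quasi-locality of the smoothing map on decorated tori, with explicit decay

Thirteenth file of the formalisation of the Michalakis–Zwolak stability theorem (hubbard.S19).
Michalakis–Zwolak, arXiv:1109.1588 §5.1, Lemma 1 (iv): for an observable `O_u(r)` supported on
the ball `b_u(r)` and the smoothing map `𝓕_w(O) = ∫ w(t) τ_t(O) dt` of a finite-range Hamiltonian,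
"`𝓕(O_u(r)) = Σ_{r' ≥ r} 𝓕(r'; O_u(r))`, where `𝓕(r'; ·)` is supported on `b_u(r')` and
`‖𝓕(r'; O_u(r))‖ ≤ ‖O_u(r)‖ f_w(r' − r)` for a rapidly-decaying `f_w`". Here:

* `exists_integral_norm_mul_min_le_div_pow` — the decay bookkeeping: for a weight with finite
  moments, `∫ |w(t)| min(C e^{−aℓ + v|t|}, 2K) dt ≤ B_p/ℓ^p` for all `ℓ ≥ 1` (split at
  `|t| = aℓ/(2v)`; MZ13 p. 9 "the usual technique of bounding the integral");
* `norm_smoothing_sub_twirl_le` — the localisation error of `𝓕_w(O)` onto the ball `b_x(r + ℓ)`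
  (`ℓ ≥ r₀`) is at most `∫ |w| min(2‖O‖(|b_x(r)|/V) e^{−⌊(ℓ+1)/(r₀+1)⌋ + 2eVJ|t|}, 2‖O‖) dt`, from
  the torus Lieb–Robinson bound (`norm_comm_heisenbergEvolution_ball_le`) and the twirl
  quasi-locality estimate (`norm_integral_smul_heisenbergEvolution_sub_twirl_le`);
* `exists_norm_smoothing_sub_twirl_le_div_pow` — **MZ13 Lemma 1 (iv)**: for every `p` a constant
  `B_p` depending only on the weight, on `V`, `J` and on a bound `N_r ≥ |b_x(r)|` (hence uniform in
  the volume) with `‖𝓕_w(O) − 𝔼(𝓕_w(O))‖ ≤ ‖O‖ B_p / ⌊(ℓ+1)/(r₀+1)⌋^p` for all `O ∈ 𝔄_{b_x(r)}`,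
  `ℓ ≥ r₀`; the pieces of the telescoping decomposition (`eq_twirl_add_sum_range_sub`) inherit
  these bounds (`norm_twirl_sub_twirl_le`).

No definitions, no named facts (theorems only).
-/

noncomputable section

open Matrix Complex NormedSpace MeasureTheory Finset Real

namespace Literature.MathematicalPhysics.QuantumLattice

section Decay

/-- `e^{-x} ≤ p! / x^p` for `x > 0`. [folklore] -/
theorem exp_neg_le_factorial_div_pow {x : ℝ} (hx : 0 < x) (p : ℕ) :
    Real.exp (-x) ≤ (Nat.factorial p : ℝ) / x ^ p := by
  have h := Real.pow_div_factorial_le_exp x (le_of_lt hx) p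
  have hf : (0 : ℝ) < Nat.factorial p := by exact_mod_cast Nat.factorial_pos p
  have hxp : 0 < x ^ p := pow_pos hx p
  rw [Real.exp_neg, inv_eq_one_div, div_le_div_iff₀ (Real.exp_pos x) hxp, one_mul]
  rw [div_le_iff₀ hf] at h
  linarith

/-- **Superpolynomial decay of a Lieb–Robinson-smeared weight.** If `w` is integrable with all
moments `∫ |t|^k |w(t)| dt` finite, then for `C, K ≥ 0`, `a, v > 0` and every `p` there is `B ≥ 0`
with `∫ |w(t)| min(C e^{−aℓ + v|t|}, 2K) dt ≤ B / ℓ^p` for all `ℓ ≥ 1` (split at `|t| = aℓ/(2v)`: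
the short times carry `e^{−aℓ/2}`, the long times the moment `∫ |t|^{p+1}|w|`). MZ13 §5.1, proof of
Lemma 1 (iv) ("bounding the integral … `≤ ‖g‖ ∫_{−T}^{T}|f| + ‖f‖ ∫_{|t|≥T}|g|`"); BMNS 2011 p. 13.
[folklore] -/
theorem exists_integral_norm_mul_min_le_div_pow {w : ℝ → ℂ} (hwi : Integrable w)
    (hmomi : ∀ k : ℕ, Integrable fun t : ℝ => ‖t‖ ^ k * ‖w t‖) {C a v K : ℝ} (hC : 0 ≤ C)
    (ha : 0 < a) (hv : 0 < v) (hK : 0 ≤ K) (p : ℕ) :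
    ∃ B : ℝ, 0 ≤ B ∧ ∀ ℓ : ℕ, 1 ≤ ℓ →
      ∫ t : ℝ, ‖w t‖ * min (C * Real.exp (-(a * ℓ) + v * |t|)) (2 * K) ≤ B / (ℓ : ℝ) ^ p := by
  set I : ℝ := ∫ t : ℝ, ‖t‖ ^ (p + 1) * ‖w t‖ with hI
  set N : ℝ := ∫ t : ℝ, ‖w t‖ with hN
  have hI0 : 0 ≤ I := integral_nonneg fun t => by positivity
  have hN0 : 0 ≤ N := integral_nonneg fun t => norm_nonneg _
  set B : ℝ := C * N * ((Nat.factorial p : ℝ) * (2 / a) ^ p) + 2 * K * I * (2 * v / a) ^ (p + 1)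
    with hB
  refine ⟨B, by positivity, fun ℓ hℓ => ?_⟩
  have hℓr : (1 : ℝ) ≤ ℓ := by exact_mod_cast hℓ
  have hℓ0 : (0 : ℝ) < ℓ := by linarith
  set T : ℝ := a * ℓ / (2 * v) with hT
  have hT0 : 0 < T := by rw [hT]; positivity
  have hvT : v * T = a * ℓ / 2 := by rw [hT]; field_simp
  -- pointwise bound
  have hpt : ∀ t : ℝ, ‖w t‖ * min (C * Real.exp (-(a * ℓ) + v * |t|)) (2 * K) ≤
      C * Real.exp (-(a * ℓ / 2)) * ‖w t‖ + 2 * K / T ^ (p + 1) * (‖t‖ ^ (p + 1) * ‖w t‖) := by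
    intro t
    have hw0 := norm_nonneg (w t)
    have h2 : 0 ≤ 2 * K / T ^ (p + 1) * (‖t‖ ^ (p + 1) * ‖w t‖) := by positivity
    have h1 : 0 ≤ C * Real.exp (-(a * ℓ / 2)) * ‖w t‖ := by positivity
    rcases le_or_gt |t| T with ht | ht
    · -- short times: use the exponential
      have hmin : min (C * Real.exp (-(a * ℓ) + v * |t|)) (2 * K) ≤ C * Real.exp (-(a * ℓ / 2)) := by
        refine (min_le_left _ _).trans (mul_le_mul_of_nonneg_left (Real.exp_le_exp.mpr ?_) hC)
        nlinarith [mul_le_mul_of_nonneg_left ht hv.le]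
      calc ‖w t‖ * min (C * Real.exp (-(a * ℓ) + v * |t|)) (2 * K)
          ≤ ‖w t‖ * (C * Real.exp (-(a * ℓ / 2))) := mul_le_mul_of_nonneg_left hmin hw0
        _ = C * Real.exp (-(a * ℓ / 2)) * ‖w t‖ := by ring
        _ ≤ _ := le_add_of_nonneg_right h2
    · -- long times: use the moment
      have hmin : min (C * Real.exp (-(a * ℓ) + v * |t|)) (2 * K) ≤ 2 * K := min_le_right _ _
      have hratio : 1 ≤ ‖t‖ ^ (p + 1) / T ^ (p + 1) := by
        rw [one_le_div (pow_pos hT0 _), Real.norm_eq_abs]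
        exact pow_le_pow_left₀ hT0.le ht.le _
      calc ‖w t‖ * min (C * Real.exp (-(a * ℓ) + v * |t|)) (2 * K)
          ≤ ‖w t‖ * (2 * K) := mul_le_mul_of_nonneg_left hmin hw0
        _ ≤ ‖w t‖ * (2 * K) * (‖t‖ ^ (p + 1) / T ^ (p + 1)) :=
            le_mul_of_one_le_right (by positivity) hratio
        _ = 2 * K / T ^ (p + 1) * (‖t‖ ^ (p + 1) * ‖w t‖) := by ring
        _ ≤ _ := le_add_of_nonneg_left h1
  -- integrate
  have hint_rhs : Integrable fun t : ℝ =>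
      C * Real.exp (-(a * ℓ / 2)) * ‖w t‖ + 2 * K / T ^ (p + 1) * (‖t‖ ^ (p + 1) * ‖w t‖) :=
    (hwi.norm.const_mul _).add ((hmomi (p + 1)).const_mul _)
  have hG : ∫ t : ℝ, ‖w t‖ * min (C * Real.exp (-(a * ℓ) + v * |t|)) (2 * K) ≤
      C * Real.exp (-(a * ℓ / 2)) * N + 2 * K / T ^ (p + 1) * I := by
    have h := integral_mono_of_nonneg (Filter.Eventually.of_forall fun t => by
        have : 0 ≤ min (C * Real.exp (-(a * ℓ) + v * |t|)) (2 * K) := le_min (by positivity) (by positivity)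
        exact mul_nonneg (norm_nonneg _) this) hint_rhs (Filter.Eventually.of_forall hpt)
    rw [integral_add (hwi.norm.const_mul _) ((hmomi (p + 1)).const_mul _), integral_const_mul,
      integral_const_mul] at h
    exact h
  -- the two elementary estimates
  have hexp : Real.exp (-(a * ℓ / 2)) ≤ (Nat.factorial p : ℝ) * (2 / a) ^ p / (ℓ : ℝ) ^ p := by
    have h := exp_neg_le_factorial_div_pow (x := a * ℓ / 2) (by positivity) p
    have heq : (Nat.factorial p : ℝ) / (a * ℓ / 2) ^ p = (Nat.factorial p : ℝ) * (2 / a) ^ p / (ℓ : ℝ) ^ p := by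
      rw [div_pow, div_pow, mul_pow]
      field_simp
    rw [← heq]
    exact h
  have htail : 2 * K / T ^ (p + 1) * I ≤ 2 * K * I * (2 * v / a) ^ (p + 1) / (ℓ : ℝ) ^ p := by
    have hTpow : T ^ (p + 1) = (a / (2 * v)) ^ (p + 1) * (ℓ : ℝ) ^ (p + 1) := by
      rw [hT, ← mul_pow]; congr 1; field_simp
    rw [hTpow]
    have hav : 0 < a / (2 * v) := by positivity
    have hℓp : (ℓ : ℝ) ^ p ≤ (ℓ : ℝ) ^ (p + 1) := by
      rw [pow_succ]; exact le_mul_of_one_le_right (by positivity) hℓr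
    rw [div_mul_eq_mul_div, div_le_div_iff₀ (by positivity) (by positivity)]
    have hinv : (2 * v / a) ^ (p + 1) * (a / (2 * v)) ^ (p + 1) = 1 := by
      rw [← mul_pow]; rw [show 2 * v / a * (a / (2 * v)) = 1 by field_simp]; simp
    calc 2 * K * I * (ℓ : ℝ) ^ p
        = 2 * K * I * ((2 * v / a) ^ (p + 1) * (a / (2 * v)) ^ (p + 1)) * (ℓ : ℝ) ^ p := by
          rw [hinv, mul_one]
      _ ≤ 2 * K * I * ((2 * v / a) ^ (p + 1) * (a / (2 * v)) ^ (p + 1)) * (ℓ : ℝ) ^ (p + 1) :=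
          mul_le_mul_of_nonneg_left hℓp (by positivity)
      _ = 2 * K * I * (2 * v / a) ^ (p + 1) * ((a / (2 * v)) ^ (p + 1) * (ℓ : ℝ) ^ (p + 1)) := by
          ring
  calc ∫ t : ℝ, ‖w t‖ * min (C * Real.exp (-(a * ℓ) + v * |t|)) (2 * K)
      ≤ C * Real.exp (-(a * ℓ / 2)) * N + 2 * K / T ^ (p + 1) * I := hG
    _ ≤ C * ((Nat.factorial p : ℝ) * (2 / a) ^ p / (ℓ : ℝ) ^ p) * N +
          2 * K * I * (2 * v / a) ^ (p + 1) / (ℓ : ℝ) ^ p :=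
        add_le_add (mul_le_mul_of_nonneg_right (mul_le_mul_of_nonneg_left hexp hC) hN0) htail
    _ = B / (ℓ : ℝ) ^ p := by rw [hB]; ring


end Decay

section Torus

open scoped Matrix.Norms.L2Operator
open Literature.Probability.LatticeModels

variable {d L : ℕ} [NeZero L] {κ : Type*} [Fintype κ] [DecidableEq κ] {q : ℕ}

/-- **Localisation error of the smoothing map on a decorated torus.** For a finite-range local
interaction (`Φ(Z) = 0` if `diam Z > r₀`, `Σ_{Z∋y}‖Φ Z‖ ≤ J`, term sizes `≤ V`), an observable `O`
on `b_x(r)`, an integrable weight `w` and `ℓ ≥ r₀`: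
`‖𝓕_w(O) − 𝔼_{b_x(r+ℓ)ᶜ}(𝓕_w(O))‖ ≤ ∫ |w(t)| min(2‖O‖ (|b_x(r)|/V) e^{−⌊(ℓ+1)/(r₀+1)⌋ + 2eVJ|t|}, 2‖O‖) dt`.
MZ13 §5.1 Lemma 1 (iv). [folklore] -/
theorem norm_smoothing_sub_twirl_le {Φ : Interaction (TorusSite d L × κ) q} (hΦ : Φ.IsLocal)
    {r₀ : ℕ} (hrange : ∀ Z, r₀ < torusDiam Z → Φ Z = 0) {J : ℝ} (hJ0 : 0 ≤ J)
    (hJ : ∀ y : TorusSite d L × κ, ∑ Z ∈ univ.filter (fun Z : Finset (TorusSite d L × κ) => y ∈ Z),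
      ‖Φ Z‖ ≤ J)
    {V : ℕ} (hV1 : 1 ≤ V) (hV : ∀ Z, Φ Z ≠ 0 → #Z ≤ V) (x : TorusSite d L) {r ℓ : ℕ} (hℓ : r₀ ≤ ℓ)
    {O : Op (TorusSite d L × κ) q} (hO : IsSupportedOn O (cellBall x r)) {w : ℝ → ℂ}
    (hw : Integrable w) :
    ‖(∫ t : ℝ, w t • heisenbergEvolution (localHamiltonian Φ univ) t O) -
        twirl (cellBall x (r + ℓ))ᶜ
          (∫ t : ℝ, w t • heisenbergEvolution (localHamiltonian Φ univ) t O)‖ ≤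
      ∫ t : ℝ, ‖w t‖ * min (2 * ‖O‖ * (#(cellBall x r : Finset (TorusSite d L × κ)) / V) *
        Real.exp (-(1 * (((ℓ + 1) / (r₀ + 1) : ℕ) : ℝ)) + 2 * Real.exp 1 * V * J * |t|)) (2 * ‖O‖) := by
  have hH : (localHamiltonian Φ univ).IsHermitian := localHamiltonian_isHermitian hΦ univ
  refine norm_integral_smul_heisenbergEvolution_sub_twirl_le hH O hw (cellBall x (r + ℓ))
    (by fun_prop) fun t U hU hUu => ?_
  have h := norm_comm_heisenbergEvolution_ball_le hΦ hrange hJ0 hJ hV1 hV x hℓ hO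
    (Y := (cellBall x (r + ℓ))ᶜ) disjoint_compl_right hU zero_le_one t
  refine h.trans ?_
  have hU1 : ‖U‖ ≤ 1 := by
    rcases subsingleton_or_nontrivial (Op (TorusSite d L × κ) q) with hs | hs
    · rw [Subsingleton.elim U 0, norm_zero]; exact zero_le_one
    · exact (CStarRing.norm_of_mem_unitary hUu).le
  have hexp : 0 ≤ Real.exp (-(1 * (((ℓ + 1) / (r₀ + 1) : ℕ) : ℝ)) + 2 * Real.exp 1 * V * J * |t|) :=
    (Real.exp_pos _).le
  calc 2 * ‖O‖ * ‖U‖ * (#(cellBall x r : Finset (TorusSite d L × κ)) / V) *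
        Real.exp (-(1 * (((ℓ + 1) / (r₀ + 1) : ℕ) : ℝ)) + 2 * Real.exp 1 * V * J * |t|)
      ≤ 2 * ‖O‖ * 1 * (#(cellBall x r : Finset (TorusSite d L × κ)) / V) *
        Real.exp (-(1 * (((ℓ + 1) / (r₀ + 1) : ℕ) : ℝ)) + 2 * Real.exp 1 * V * J * |t|) := by
        gcongr
    _ = _ := by ring

/-- **MZ13 Lemma 1 (iv) (quasi-locality of the smoothing map with superpolynomial decay, uniform
in the volume).** For a weight `w` with all moments finite and every `p` there is `B ≥ 0`,
depending only on `w`, `p`, `V`, `J` and a bound `N_r` for `|b_x(r)|`, such that for every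
observable `O` on `b_x(r)` and every `ℓ ≥ r₀`,
`‖𝓕_w(O) − 𝔼_{b_x(r+ℓ)ᶜ}(𝓕_w(O))‖ ≤ ‖O‖ · B / ⌊(ℓ+1)/(r₀+1)⌋^p`.
[cite: MichalakisZwolakCMP2013, §5.1 Lemma 1 (iv) (arXiv:1109.1588 p. 9)] -/
theorem exists_norm_smoothing_sub_twirl_le_div_pow {w : ℝ → ℂ} (hw : Integrable w)
    (hmomi : ∀ k : ℕ, Integrable fun t : ℝ => ‖t‖ ^ k * ‖w t‖) {J : ℝ} (hJ0 : 0 ≤ J)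
    {V : ℕ} (hV1 : 1 ≤ V) (N_r : ℕ) (r₀ r p : ℕ) :
    ∃ B : ℝ, 0 ≤ B ∧ ∀ {Φ : Interaction (TorusSite d L × κ) q}, Φ.IsLocal →
      (∀ Z, r₀ < torusDiam Z → Φ Z = 0) →
      (∀ y : TorusSite d L × κ, ∑ Z ∈ univ.filter (fun Z : Finset (TorusSite d L × κ) => y ∈ Z),
        ‖Φ Z‖ ≤ J) →
      (∀ Z, Φ Z ≠ 0 → #Z ≤ V) → ∀ (x : TorusSite d L),
      #(cellBall x r : Finset (TorusSite d L × κ)) ≤ N_r →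
      ∀ {O : Op (TorusSite d L × κ) q}, IsSupportedOn O (cellBall x r) → ∀ {ℓ : ℕ}, r₀ ≤ ℓ →
      ‖(∫ t : ℝ, w t • heisenbergEvolution (localHamiltonian Φ univ) t O) -
          twirl (cellBall x (r + ℓ))ᶜ
            (∫ t : ℝ, w t • heisenbergEvolution (localHamiltonian Φ univ) t O)‖ ≤
        ‖O‖ * B / ((((ℓ + 1) / (r₀ + 1) : ℕ) : ℝ)) ^ p := by
  -- the decay constant for `C = 2 N_r / V`, `a = 1`, `v = 2eVJ + 1`, `K = 1`
  have hv : 0 < 2 * Real.exp 1 * V * J + 1 := by positivity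
  obtain ⟨B, hB0, hB⟩ := exists_integral_norm_mul_min_le_div_pow hw hmomi
    (C := 2 * N_r / V) (by positivity) one_pos hv zero_le_one p
  refine ⟨B, hB0, fun hΦ hrange hJ hV x hcard O hO ℓ hℓ => ?_⟩
  set ℓ' : ℕ := (ℓ + 1) / (r₀ + 1) with hℓ'
  have hℓ'1 : 1 ≤ ℓ' := Nat.div_pos (by omega) (Nat.succ_pos r₀)
  have h1 := norm_smoothing_sub_twirl_le hΦ hrange hJ0 hJ hV1 hV x hℓ hO hw
  refine h1.trans ?_
  -- compare the integrands: factor `‖O‖` and enlarge the constants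
  have hO0 := norm_nonneg O
  have hVr : (0 : ℝ) < V := by exact_mod_cast hV1
  have hpt : ∀ t : ℝ, ‖w t‖ * min (2 * ‖O‖ * (#(cellBall x r : Finset (TorusSite d L × κ)) / V) *
      Real.exp (-(1 * (ℓ' : ℝ)) + 2 * Real.exp 1 * V * J * |t|)) (2 * ‖O‖) ≤
      ‖O‖ * (‖w t‖ * min (2 * N_r / V * Real.exp (-(1 * (ℓ' : ℝ)) + (2 * Real.exp 1 * V * J + 1) * |t|))
        (2 * 1)) := by
    intro t
    rw [mul_left_comm]
    refine mul_le_mul_of_nonneg_left ?_ (norm_nonneg _)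
    have hcard' : (#(cellBall x r : Finset (TorusSite d L × κ)) : ℝ) ≤ N_r := by exact_mod_cast hcard
    have hexp : Real.exp (-(1 * (ℓ' : ℝ)) + 2 * Real.exp 1 * V * J * |t|) ≤
        Real.exp (-(1 * (ℓ' : ℝ)) + (2 * Real.exp 1 * V * J + 1) * |t|) :=
      Real.exp_le_exp.mpr (by nlinarith [abs_nonneg t])
    have hA : 2 * ‖O‖ * (#(cellBall x r : Finset (TorusSite d L × κ)) / V) *
          Real.exp (-(1 * (ℓ' : ℝ)) + 2 * Real.exp 1 * V * J * |t|) ≤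
        ‖O‖ * (2 * N_r / V * Real.exp (-(1 * (ℓ' : ℝ)) + (2 * Real.exp 1 * V * J + 1) * |t|)) := by
      calc 2 * ‖O‖ * (#(cellBall x r : Finset (TorusSite d L × κ)) / V) *
            Real.exp (-(1 * (ℓ' : ℝ)) + 2 * Real.exp 1 * V * J * |t|)
          ≤ 2 * ‖O‖ * (N_r / V) * Real.exp (-(1 * (ℓ' : ℝ)) + (2 * Real.exp 1 * V * J + 1) * |t|) := by
            gcongr
        _ = ‖O‖ * (2 * N_r / V * Real.exp (-(1 * (ℓ' : ℝ)) + (2 * Real.exp 1 * V * J + 1) * |t|)) := by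
            ring
    rcases le_total (2 * N_r / V * Real.exp (-(1 * (ℓ' : ℝ)) + (2 * Real.exp 1 * V * J + 1) * |t|))
      (2 * 1) with hce | hce
    · rw [min_eq_left hce]
      exact (min_le_left _ _).trans hA
    · rw [min_eq_right hce]
      exact (min_le_right _ _).trans (le_of_eq (by ring))
  have hint : Integrable fun t : ℝ => ‖O‖ * (‖w t‖ *
      min (2 * N_r / V * Real.exp (-(1 * (ℓ' : ℝ)) + (2 * Real.exp 1 * V * J + 1) * |t|)) (2 * 1)) := by
    refine ((hw.norm.mul_const (2 * 1)).const_mul ‖O‖).mono' ?_ (Filter.Eventually.of_forall fun t => ?_)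
    · exact ((hw.aestronglyMeasurable.norm.mul (by fun_prop : Continuous fun t : ℝ =>
        min (2 * N_r / V * Real.exp (-(1 * (ℓ' : ℝ)) + (2 * Real.exp 1 * V * J + 1) * |t|))
          (2 * 1)).aestronglyMeasurable).const_mul ‖O‖)
    · rw [Real.norm_eq_abs, abs_mul, abs_mul, abs_norm, abs_norm]
      refine mul_le_mul_of_nonneg_left (mul_le_mul_of_nonneg_left ?_ (norm_nonneg _)) hO0
      rw [abs_le]; constructor
      · have : 0 ≤ min (2 * N_r / V * Real.exp (-(1 * (ℓ' : ℝ)) + (2 * Real.exp 1 * V * J + 1) * |t|))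
          (2 * 1) := le_min (by positivity) (by norm_num)
        linarith
      · exact min_le_right _ _
  calc ∫ t : ℝ, ‖w t‖ * min (2 * ‖O‖ * (#(cellBall x r : Finset (TorusSite d L × κ)) / V) *
          Real.exp (-(1 * (ℓ' : ℝ)) + 2 * Real.exp 1 * V * J * |t|)) (2 * ‖O‖)
      ≤ ∫ t : ℝ, ‖O‖ * (‖w t‖ *
          min (2 * N_r / V * Real.exp (-(1 * (ℓ' : ℝ)) + (2 * Real.exp 1 * V * J + 1) * |t|)) (2 * 1)) :=
        integral_mono_of_nonneg (Filter.Eventually.of_forall fun t => mul_nonneg (norm_nonneg _)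
          (le_min (by positivity) (by positivity))) hint (Filter.Eventually.of_forall hpt)
    _ = ‖O‖ * ∫ t : ℝ, ‖w t‖ *
          min (2 * N_r / V * Real.exp (-(1 * (ℓ' : ℝ)) + (2 * Real.exp 1 * V * J + 1) * |t|)) (2 * 1) :=
        integral_const_mul _ _
    _ ≤ ‖O‖ * (B / (ℓ' : ℝ) ^ p) := mul_le_mul_of_nonneg_left (hB ℓ' hℓ'1) hO0
    _ = ‖O‖ * B / (ℓ' : ℝ) ^ p := by ring

end Torus

end Literature.MathematicalPhysics.QuantumLattice
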